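import Summits.MatrixMultiplication.OmegaCensus.STPPSmallPatternKernelSearch

/-!
# STPP (2,1,1) COSET LAW — part B: the kernel engine for rooted admissible labeled sets in `𝔽₂⁶` (definitions only)

Cell `pub-omega` (unit `pub-omega-stpp-1-g36`), topic `Summits/MatrixMultiplication/OmegaCensus`.
HONEST FRAMING (verbatim): lottery ticket; floor = certified bounds/negative ranges. Census STRUCTURE bookkeeping (B5, `T1((ℤ/2)⁶)`, Pb237;
mechanism class of X-38); nothing here is a bound on `ω`.

THE OBJECT SEARCHED (see `STPP211CosetLaw`, `T1Coset.CosetBound`). Codes `0 … 63` of `𝔽₂⁶` (addition = `Nat.xor`), a `c`-code list `cs`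
of length `k`, the coordinate hyperplane `W = {x : bit b of x = 0}`. A ROOTED `W`-ADMISSIBLE LABELED SET is a set `Q` of pairs `(x, t)`,
`x ∈ W`, `t < k`, with: `(0, s) ∈ Q` and every label `≥ s` (the root label `s`); each label at most twice; and for two distinct members
`(x, t) ≠ (y, l)`: `x + y ∉ P_t ∪ P_l`, `P_t = c_t + C` (the pairwise form of CKSU Def. 5.1 in characteristic 2). `search cs b T = true`
says: for every root label `s < k`, every such `Q` has FEWER THAN `T` members (soundness: `STPP211CosetReflect`).

THE ENGINE. For labels `t, l` let `F t l = (P_t ∪ P_l) ∩ W` and `E t l x = W ∖ (x + F t l)` (the label-`t` candidates compatible with a member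
`(x, l)`). The state is ONE packed number `K` of `k` LANES of 64 bits (lane `t` = current candidate mask of label `t`); choosing a member
`(x, l)` is `K ∧ LV l x` with the precomputed LANE VECTOR `LV l x = Σ_t E t l x · 2^(64 t)`, read off the packed table of label `l`
(`64` fields of `64 k` bits; `mkTabs`). LABEL-MAJOR depth-first search from the root `(0, s)` (`K₀ = LV s 0`): labels `s` (one more point
allowed), `s+1, …, k−1` (two points allowed) in this order; for the current label `u` with lane `L`: no point, or one point `x ∈ L`, or two
points `x < y` with `y ∈` lane `u` of `K ∧ LV u x`; CAPACITY BOUND: a node is refuted outright when `n + Σ_{open v} min(2, #lane_v) < T`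
(`min(2, #lane)` read by two lowest-bit removals); a leaf (all labels decided) is refuted iff `n < T`. Idioms `force` / `allBits` / `lowBit` /
`bit` / `lowMask` of `STPPSmallPatternKernelSearch` (seat pub-omega-stpp-3); every mask is evaluated once.
Desk twins: HOME `pub-omega-stpp-1-g36/code/` (`labm.c`, `engine_mirror.py`; e.g. `cs = [0,1,2,3,4,5,8,9,16,17]`, `b = 5`, `T = 10`:
61 249 calls).

References: H. Cohn, R. Kleinberg, B. Szegedy, C. Umans, FOCS 2005 (arXiv:math/0511460), Def. 5.1.
-/

namespace Summit.MatrixMultiplication.OmegaCensus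

namespace T1CosetEng

open STPP211Neg

/-! ## Masks, translates, packed fields -/

/-- The mask `2⁶⁴ − 1` of all 64 codes of `𝔽₂⁶`. -/
def full6 : ℕ := 18446744073709551615

/-- `⋃_{x ∈ F} f x` over the set bits `x` of `F`, lowest first, at most `fuel` of them (recursor form, as `allBits`). -/
noncomputable def foldOr (f : ℕ → ℕ) (fuel : ℕ) : ℕ → ℕ :=
  @Nat.rec (fun _ => ℕ → ℕ) (fun _ => 0)
    (fun _ ih F => @Bool.rec (fun _ => ℕ)
      (force (lowBit F) fun L => Nat.lor (f (Nat.log2 L)) (ih (Nat.xor F L))) 0 (Nat.beq F 0))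
    fuel

/-- XOR-translate of a mask: `{x + t : x ∈ M}` on codes (`+` = `Nat.xor`). -/
noncomputable def xsh (M t : ℕ) : ℕ := foldOr (fun x => bit (Nat.xor x t)) M M

/-- Mask of a list of codes. -/
def maskOf : List ℕ → ℕ
  | [] => 0
  | c :: cs => Nat.lor (bit c) (maskOf cs)

/-- PACKING: `Σ_{i < n} f i · 2^(w i)` (fields of width `w`). -/
noncomputable def pack (w : ℕ) (f : ℕ → ℕ) (n : ℕ) : ℕ :=
  @Nat.rec (fun _ => ℕ) 0 (fun i acc => Nat.lor acc (Nat.shiftLeft (f i) (Nat.mul w i))) n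

/-- Field `i` (width `w`) of a packed number. -/
def fld (w X i : ℕ) : ℕ := Nat.land (Nat.shiftRight X (Nat.mul w i)) (lowMask w)

/-- The mask of the coordinate hyperplane `W = {x < 64 : bit b of x = 0}`. -/
noncomputable def wmask (b : ℕ) : ℕ :=
  foldOr (fun x => @Bool.rec (fun _ => ℕ) (bit x) 0 (Nat.testBit x b)) full6 full6

/-! ## The tables -/

/-- `P t = c_t + C` (mask). -/
noncomputable def pmask (cs : List ℕ) (t : ℕ) : ℕ := xsh (maskOf cs) (cs.getD t 0)

/-- `E t l x = W ∖ (x + ((P_t ∪ P_l) ∩ W))`: the label-`t` candidates compatible with a member `(x, l)`. -/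
noncomputable def emask (cs : List ℕ) (W t l x : ℕ) : ℕ :=
  Nat.land W (Nat.xor full6 (xsh (Nat.land (Nat.lor (pmask cs t) (pmask cs l)) W) x))

/-- LANE VECTOR `LV l x = Σ_{t < k} E t l x · 2^(64 t)`. -/
noncomputable def lvec (cs : List ℕ) (W k l x : ℕ) : ℕ := pack 64 (fun t => emask cs W t l x) k

/-- The packed table of label `l`: field `x < 64` (width `64 k`) is `LV l x`. -/
noncomputable def tab (cs : List ℕ) (W k l : ℕ) : ℕ := pack (Nat.mul 64 k) (lvec cs W k l) 64

/-- The list of the `k` tables (label `0` first). -/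
noncomputable def mkTabs (cs : List ℕ) (W k : ℕ) : List ℕ := (List.range k).map (tab cs W k)

/-- Lane `t` of a packed state. -/
def lane (K t : ℕ) : ℕ := fld 64 K t

/-- Field `x` of a table of lane width `64 k`: the lane vector `LV l x`. -/
def lv (k Tl x : ℕ) : ℕ := fld (Nat.mul 64 k) Tl x

/-! ## The search -/

/-- `min(2, #M)` for a mask `M` (two lowest-bit removals). -/
def upTo2 (M : ℕ) : ℕ :=
  @Bool.rec (fun _ => ℕ) (@Bool.rec (fun _ => ℕ) 2 1 (Nat.beq (Nat.land M (Nat.sub M 1)) 0)) 0 (Nat.beq M 0)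

/-- CAPACITY of the open two-point labels `rest` in the state `K`: `Σ_{v ∈ rest} min(2, #lane_v)`. -/
def cap2 (K : ℕ) : List ℕ → ℕ :=
  @List.rec ℕ (fun _ => ℕ) 0 (fun v _ acc => Nat.add (upTo2 (lane K v)) acc)

/-- THE SEARCH BELOW THE ROOT LABEL. `go k tabs T rest n K`: labels `rest` still open (two points allowed each), `n` members so far, lanes
`K`; `true` = every completion has fewer than `T` members. Node: prune by the capacity bound; else «no point for `u`» ∧ ∀ `x ∈ lane u`:
(«`(x,u)` alone» ∧ ∀ `y > x` in lane `u` of `K ∧ LV u x`: «`(x,u), (y,u)`»). Leaf: `n < T`. -/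
noncomputable def go (k : ℕ) (tabs : List ℕ) (T : ℕ) : List ℕ → ℕ → ℕ → Bool :=
  @List.rec ℕ (fun _ => ℕ → ℕ → Bool) (fun n _ => Nat.blt n T)
    (fun u rest ih n K =>
      force (cap2 K (u :: rest)) fun bnd =>
      Nat.blt (Nat.add n bnd) T ||
      (ih n K &&
        force (tabs.getD u 0) fun Tu =>
        force (lane K u) fun L =>
        allBits L (fun x =>
          force (Nat.land K (lv k Tu x)) fun K1 =>
          ih (Nat.add n 1) K1 &&
          force (Nat.land (lane K1 u) (Nat.xor full6 (lowMask (Nat.add x 1)))) fun L2 =>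
          allBits L2 (fun y => ih (Nat.add n 2) (Nat.land K1 (lv k Tu y))) L2)
        L))

/-- The labels `s+1, …, k−1` (the open two-point labels below the root label `s`), ascending. -/
def restOf (k s : ℕ) : List ℕ := (List.range (k - (s + 1))).map fun j => s + 1 + j

/-- THE ROOT `s`: the member `(0, s)` is placed (`K₀ = LV s 0`, `n = 1`), label `s` may take ONE more point `x` (then `n = 2`), then
the labels `restOf k s`. Capacity bound at the root: `1 + min(1, #lane_s) + cap2`. -/
noncomputable def root (k : ℕ) (tabs : List ℕ) (T s : ℕ) : Bool :=
  force (tabs.getD s 0) fun Ts =>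
  force (lv k Ts 0) fun K0 =>
  force (lane K0 s) fun L =>
  force (Nat.add (@Bool.rec (fun _ => ℕ) 1 0 (Nat.beq L 0)) (cap2 K0 (restOf k s))) fun bnd =>
  Nat.blt (Nat.add 1 bnd) T ||
  (go k tabs T (restOf k s) 1 K0 &&
    allBits L (fun x => go k tabs T (restOf k s) 2 (Nat.land K0 (lv k Ts x))) L)

/-- **THE SEARCH.** `search cs b T = true` certifies: for the `c`-code list `cs` (`k` = its length) and the hyperplane «bit `b` = 0», every
rooted admissible labeled set, for every root label `s < k`, has fewer than `T` members (`STPP211CosetReflect`). -/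
noncomputable def search (cs : List ℕ) (b T : ℕ) : Bool :=
  force (wmask b) fun W =>
  (List.range cs.length).all (root cs.length (mkTabs cs W cs.length) T)

/-! ## v2 — SALTED states (the engine actually decided by the kernel)

KERNEL FINDING (this seat, 2026-08-29): the kernel's hash of a big `ℕ` literal only sees its low word, so the thousands of packed states `K`
of one search — which share lane `0` most of the time — collide in the type checker's `whnf` cache and the search turns QUADRATIC
(rep. `[0,1,2,3,4,5,8,10,12,14]`, root `0`, `T = 8`: 39 000 calls > 300 s; with the salt below: 12 s). REMEDY: field `0` of the state is
a SALT — the XOR of the multiplicative hashes `salt u x` of the members chosen so far — and the `k` lanes sit in fields `1 … k`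
(`laneS K t = lane K (t+1)`, lane vectors `lvecS = LV · 2⁶⁴ + (2⁶⁴ − 1)` so that `∧` keeps the salt, tables `tabS` of field width
`64 (k+1)`, `lvS k = lv (k+1)`). `goS` / `rootS` / `searchS` are `go` / `root` / `search` with these readers and the update
`K₁ = (K ⊕ salt u x) ∧ LVS u x`; the salt never influences a decision (soundness: `STPP211CosetReflectB`). -/

/-- SALT of the member `(x, u)`: a multiplicative hash in `[0, 2⁶⁴)` (Fibonacci constant). -/
def salt (u x : ℕ) : ℕ :=
  Nat.mod (Nat.mul (Nat.add (Nat.add x (Nat.mul 64 u)) 1) 11400714819323198485) 18446744073709551616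

/-- Salted LANE VECTOR: `LV l x` moved up one field, field `0` all ones. -/
noncomputable def lvecS (cs : List ℕ) (W k l x : ℕ) : ℕ := Nat.lor (Nat.shiftLeft (lvec cs W k l x) 64) (lowMask 64)

/-- Salted table of label `l`: field `x < 64` (width `64 (k+1)`) is `lvecS l x`. -/
noncomputable def tabS (cs : List ℕ) (W k l : ℕ) : ℕ := pack (Nat.mul 64 (Nat.add k 1)) (lvecS cs W k l) 64

/-- The list of the `k` salted tables. -/
noncomputable def mkTabsS (cs : List ℕ) (W k : ℕ) : List ℕ := (List.range k).map (tabS cs W k)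

/-- Lane `t` of a salted state (field `t + 1`). -/
def laneS (K t : ℕ) : ℕ := lane K (Nat.add t 1)

/-- Field `x` of a salted table. -/
def lvS (k Tl x : ℕ) : ℕ := lv (Nat.add k 1) Tl x

/-- Salted CAPACITY: `Σ_{v ∈ rest} min(2, #laneS_v)`. -/
def cap2S (K : ℕ) : List ℕ → ℕ :=
  @List.rec ℕ (fun _ => ℕ) 0 (fun v _ acc => Nat.add (upTo2 (laneS K v)) acc)

/-- THE SALTED SEARCH BELOW THE ROOT LABEL (`go` with `laneS` / `lvS` and the salted update). -/
noncomputable def goS (k : ℕ) (tabs : List ℕ) (T : ℕ) : List ℕ → ℕ → ℕ → Bool :=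
  @List.rec ℕ (fun _ => ℕ → ℕ → Bool) (fun n _ => Nat.blt n T)
    (fun u rest ih n K =>
      force (cap2S K (u :: rest)) fun bnd =>
      Nat.blt (Nat.add n bnd) T ||
      (ih n K &&
        force (tabs.getD u 0) fun Tu =>
        force (laneS K u) fun L =>
        allBits L (fun x =>
          force (Nat.land (Nat.xor K (salt u x)) (lvS k Tu x)) fun K1 =>
          ih (Nat.add n 1) K1 &&
          force (Nat.land (laneS K1 u) (Nat.xor full6 (lowMask (Nat.add x 1)))) fun L2 =>
          allBits L2 (fun y => ih (Nat.add n 2) (Nat.land (Nat.xor K1 (salt u y)) (lvS k Tu y))) L2)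
        L))

/-- THE SALTED ROOT `s` (`root` with `laneS` / `lvS` and the salted update). -/
noncomputable def rootS (k : ℕ) (tabs : List ℕ) (T s : ℕ) : Bool :=
  force (tabs.getD s 0) fun Ts =>
  force (lvS k Ts 0) fun K0 =>
  force (laneS K0 s) fun L =>
  force (Nat.add (@Bool.rec (fun _ => ℕ) 1 0 (Nat.beq L 0)) (cap2S K0 (restOf k s))) fun bnd =>
  Nat.blt (Nat.add 1 bnd) T ||
  (goS k tabs T (restOf k s) 1 K0 &&
    allBits L (fun x => goS k tabs T (restOf k s) 2 (Nat.land (Nat.xor K0 (salt s x)) (lvS k Ts x))) L)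

/-- **THE SALTED SEARCH** (the one the census decides): `searchS cs b T = true` certifies that every rooted admissible labeled set, for
every root label `s < |cs|`, has fewer than `T` members (`STPP211CosetReflectB.cosetBound_of_searchS`). -/
noncomputable def searchS (cs : List ℕ) (b T : ℕ) : Bool :=
  force (wmask b) fun W =>
  (List.range cs.length).all (rootS cs.length (mkTabsS cs W cs.length) T)

end T1CosetEng

end Summit.MatrixMultiplication.OmegaCensus
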